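import Literature.AlgebraicGeometry.Frobenioids.BirationalizationCategory
import HarnessLib

/-!
# Frobenioids I, Proposition 4.4 (ii)/(iv): `O^×(A^birat)` inside `Aut_{C^birat}(A^birat)`

Mochizuki, *The geometry of Frobenioids I: the general theory*, Kyushu J. Math. **62** (2008)
293–400, §4, Proposition 4.4 (ii), (iv), kurims text p. 83 [cite: MochizukiFrdI2008, Prop. 4.4(iv)
p.83].

`BiratUnits.lean` builds the unit group `O^×(A^birat)` of the birationalization directly from pairs
of
base-equivalent co-angular pre-steps; `BirationalizationCategory.lean` builds the category `C^birat`
itself.  This file provides the bridge: the class of a pair `(α, φ)` IS the birational automorphism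
"`φ ∘ α⁻¹`" of `A^birat` — an injective group homomorphism
`BiratUnits.toAut : O^×(A^birat) →* Aut_{C^birat}(A^birat)` (Prop. 4.4 (iv): such pairs are exactly
the base-identity linear automorphisms; (ii): `O^▷(A)^gp ↪ O^×(A^birat)` is computed inside
`Aut(A^birat)`).  The square-completion hypothesis `hsq : HasBiratSquares F` (Prop. 1.11 (vii),
TODO-merge abc-iut-L1-t1) is inherited from the category.
-/

namespace Literature.AlgebraicGeometry.Frobenioids

open CategoryTheory Opposite

universe w v v' u u'

namespace PreFrobenioid

variable {D : Type u} [Category.{v} D] {Φ : Dᵒᵖ ⥤ CommMonCat.{w}}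
  {C : Type u'} [Category.{v'} C] {F : C ⥤ ElemFrobenioid Φ} {hF : IsFrobenioid F}
  {hsq : HasBiratSquares F} {A : C}

namespace RatFrac

/-- A fraction of units `(α, φ)` as a birational fraction `A ⇢ A`.
[cite: MochizukiFrdI2008, Prop. 4.4(iv) p.83] -/
def toBiratFrac (p : RatFrac F A) : BiratFrac F A A := ⟨p.src, p.den, p.num, p.den_mem⟩

/-- The two refinement relations agree. [cite: MochizukiFrdI2008, Prop. 4.4(iv) p.83] -/
theorem toBiratFrac_rel {p q : RatFrac F A} (h : Rel p q) :
    BiratFrac.Rel p.toBiratFrac q.toBiratFrac := by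
  obtain ⟨E, ε, ε', hε, hε', h₁, h₂⟩ := h
  exact ⟨E, ε, ε', hε, hε', h₁, h₂⟩

/-- … in both directions. [cite: MochizukiFrdI2008, Prop. 4.4(iv) p.83] -/
theorem rel_of_toBiratFrac_rel {p q : RatFrac F A} (h : BiratFrac.Rel p.toBiratFrac q.toBiratFrac) :
    Rel p q := by
  obtain ⟨E, ε, ε', hε, hε', h₁, h₂⟩ := h
  exact ⟨E, ε, ε', hε, hε', h₁, h₂⟩

end RatFrac

namespace BiratUnits

variable (hsq) in
/-- The birational endomorphism "`φ ∘ α⁻¹`" of `A^birat` defined by a rational function `[(α, φ)]`.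
[cite: MochizukiFrdI2008, Prop. 4.4(iv) p.83] -/
noncomputable def toHom (u : BiratUnits F hF A) :
    (toBirat F hF hsq).obj A ⟶ (toBirat F hF hsq).obj A :=
  Quotient.lift (s := RatFrac.setoid F hF A)
    (fun p => (Birat.homMk p.toBiratFrac : (toBirat F hF hsq).obj A ⟶ (toBirat F hF hsq).obj A))
    (fun _ _ h => Birat.homMk_sound (RatFrac.toBiratFrac_rel h)) u

/-- `toHom` on the class of a fraction. [cite: MochizukiFrdI2008, Prop. 4.4(iv) p.83] -/
theorem toHom_mk (p : RatFrac F A) : toHom hsq (mk hF p) = Birat.homMk p.toBiratFrac := rfl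

/-- `toHom` is injective (the relations agree). [cite: MochizukiFrdI2008, Prop. 4.4(iv) p.83] -/
theorem toHom_injective : Function.Injective (toHom hsq : BiratUnits F hF A → _) := by
  intro u v huv
  obtain ⟨p, rfl⟩ := mk_surjective u
  obtain ⟨q, rfl⟩ := mk_surjective v
  rw [toHom_mk, toHom_mk] at huv
  exact sound (RatFrac.rel_of_toBiratFrac_rel (Birat.homMk_eq_homMk_iff.mp huv))

/-- `toHom 1 = id`. [cite: MochizukiFrdI2008, Prop. 4.4(iv) p.83] -/
theorem toHom_one : toHom hsq (1 : BiratUnits F hF A) = 𝟙 _ := rfl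

/-- `toHom (u · v) = toHom v ≫ toHom u` (the product of `O^×(A^birat)` is "`u ∘ v`").
[cite: MochizukiFrdI2008, Prop. 4.4(iv) p.83] -/
theorem toHom_mul (u v : BiratUnits F hF A) : toHom hsq (u * v) = toHom hsq v ≫ toHom hsq u := by
  obtain ⟨p, rfl⟩ := mk_surjective u
  obtain ⟨q, rfl⟩ := mk_surjective v
  rw [mk_mul_mk, toHom_mk, toHom_mk, toHom_mk]
  let R := RatFrac.someRefinement hF q p
  let S : BiratFrac.Square q.toBiratFrac p.toBiratFrac :=
    { apex := R.apex, left := R.left, right := R.right, left_mem := R.left_mem, w := R.w }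
  exact (Birat.homMk_comp_homMk_eq (X := Birat.of F hF hsq A) (Y := Birat.of F hF hsq A)
    (Z := Birat.of F hF hsq A) _ _ S).symm

/-- `toHom u⁻¹ ≫ toHom u = id`. [cite: MochizukiFrdI2008, Prop. 4.4(iv) p.83] -/
theorem toHom_inv_comp (u : BiratUnits F hF A) : toHom hsq u⁻¹ ≫ toHom hsq u = 𝟙 _ := by
  rw [← toHom_mul, mul_inv_cancel, toHom_one]

/-- `toHom u ≫ toHom u⁻¹ = id`. [cite: MochizukiFrdI2008, Prop. 4.4(iv) p.83] -/
theorem toHom_comp_inv (u : BiratUnits F hF A) : toHom hsq u ≫ toHom hsq u⁻¹ = 𝟙 _ := by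
  rw [← toHom_mul, inv_mul_cancel, toHom_one]

variable (hsq) in
/-- **Prop. 4.4 (iv)/(ii)**: `O^×(A^birat) → Aut_{C^birat}(A^birat)`, `[(α, φ)] ↦ φ ∘ α⁻¹`, a group
homomorphism (for Mathlib's `Aut`, `x * y = y ≪≫ x`). [cite: MochizukiFrdI2008, Prop. 4.4(iv) p.83]
-/
noncomputable def toAut : BiratUnits F hF A →* Aut ((toBirat F hF hsq).obj A) where
  toFun u := ⟨toHom hsq u, toHom hsq u⁻¹, toHom_comp_inv u, toHom_inv_comp u⟩
  map_one' := by
    apply Iso.ext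
    exact toHom_one
  map_mul' u v := by
    apply Iso.ext
    exact toHom_mul u v

/-- The underlying morphism of `toAut u`. [cite: MochizukiFrdI2008, Prop. 4.4(iv) p.83] -/
theorem toAut_hom (u : BiratUnits F hF A) : (toAut hsq u).hom = toHom hsq u := rfl

/-- `toAut` is injective. [cite: MochizukiFrdI2008, Prop. 4.4(iv) p.83] -/
theorem toAut_injective : Function.Injective (toAut hsq : BiratUnits F hF A → _) :=
  fun _ _ h => toHom_injective (congrArg Iso.hom h)

/-- Compatibility with `O^×(A) → O^×(A^birat)`: the unit `u ∈ O^×(A)` maps to the image of the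
automorphism `u` of `A` under `C → C^birat` (Prop. 4.4 (ii): the injection `O^▷(A)^gp ↪
O^×(A^birat)` is
"determined by the functor `C → C^birat`"). [cite: MochizukiFrdI2008, Prop. 4.4(ii) p.83] -/
theorem toHom_unitsToBirat_spec (u : unitsSubgroup F A) :
    toHom hsq (mk hF ⟨A, 𝟙 A, u.1.hom, isCoAngularPreStep_id hF A,
      isCoAngularPreStep_of_mem_unitsSubgroup hF u.1 u.2,
      by change Base F (𝟙 A) = Base F u.1.hom; rw [base_id, u.2.1]⟩) =
      (toBirat F hF hsq).map u.1.hom := rfl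

end BiratUnits

end PreFrobenioid

end Literature.AlgebraicGeometry.Frobenioids
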